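import Literature.NumberTheory.LFunctions.LagariasDifferencedXiCountingProofs
import Literature.NumberTheory.LFunctions.LagariasDifferencedXiSpacingsProofs
import Literature.NumberTheory.LFunctions.LagariasDifferencedXiSpacingsLogDerivProofs
import HarnessLib

/-!
# Lagarias 2005, Theorem 4.1: trivial limiting distribution of the normalised zero spacings of `A_{h,θ}`, `B_{h,θ}`

LINE 1 — LABEL: RH-FREE (Theorem 4.1 (1)); Theorem 4.1 (2) is an RH-CONSEQUENCE whose RH binder is a hypothesis
of the discharged statement, never dropped and never asserted. bears_on: LADDER-RH B-C/B-P (COLUMN 6, de Branges).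
WHAT THIS IS NOT: a statement about the spacings of the critical-line zeros of the AUXILIARY entire functions
`A_{h,θ}(s) = ½(E + E♯)`, `B_{h,θ}` built from `ξ(s + h)`, `|h| ≥ ½` — not about zeros of `ξ`, not a route, not
progress toward RH; nothing here bears on the truth of RH.

Targets (cell rh-crit/dbl, corpus C2, source S5, node La05:T4.1; statements typed in
`LagariasDifferencedXiSpacings.lean`): J. C. Lagarias, *Zero spacing distributions for differenced L-functions*,
Acta Arith. 120 (2005) 159–184 = arXiv:math/0601653 [Lagarias2005], **Theorem 4.1** (arXiv p. 8; held text
`paper:arxiv-math_0601653` p0008:L71–87, proof p0008:L89–p0009): (1) for `|h| ≥ ½`, `0 ≤ θ < 2π`, `k ≥ 1` the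
`k` consecutive normalised zero spacings of `A_{h,θ}` and of `B_{h,θ}` have the trivial limiting distribution
`δ_{(1,…,1)}` (`lagarias2005_thm_4_1_1`); (2) under RH the same for `0 < |h| < ½` (`lagarias2005_thm_4_1_2`).

## What is proved here, and modulo what

* `Literature.NumberTheory.LFunctions.lagarias2005_thm_4_1_1_holds : lagarias2005_thm_4_1_1` — DISCHARGE of
  Theorem 4.1 (1), from Lemma 4.1 (1) (`|h| > ½`, tree theorem `lagarias2005_lemma_4_1_1_holds`) and Lemma 4.1
  (2) (`|h| = ½`: `ζ′/ζ(1 + it) = O(log t/log log t)`, [Titchmarsh1986, (5.17.4)], tree theorem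
  `lagarias2005_lemma_4_1_2_holds`).
* `Literature.NumberTheory.LFunctions.lagarias2005_thm_4_1_2_of_lemma_4_1_3 :
  lagarias2005_lemma_4_1_3 → lagarias2005_thm_4_1_2` — Theorem 4.1 (2) (RH binder kept) from Lemma 4.1 (3)
  ([Titchmarsh1986, Thm 14.5] under RH; the named fact `lagarias2005_lemma_4_1_3` of the tree, taken BY NAME
  as the hypothesis, not restated).
No definition and no named fact is introduced.

## The printed proof and how it is followed

Lagarias (pp. 8–9): the zeros `½ + iγ_n` of `A_{h,θ}` on the critical line are the solutions of
`φ_h(γ) ≡ π/2 + θ (mod π)` for the continuous phase `φ_h` of `ξ(½ + h + it)` (proof of Theorem 3.1), whose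
velocity is `φ_h′(t) = Re ξ′/ξ(½ + h + it) = ½ log(t/2π) + O(1/t) + Re ζ′/ζ(½ + h + it)` by
`ξ = ½s(s−1)π^{−s/2}Γ(s/2)ζ(s)` and Stirling; Lemma 4.1 makes the last term `o(log t)` (bounded for `|h| > ½`,
`O(log t/log log t)` at `|h| = ½`, `O((log t)^{1−2|h|})` under RH for `0 < |h| < ½`), so consecutive zeros satisfy
`π = φ_h(γ_{n+1}) − φ_h(γ_n) = (γ_{n+1} − γ_n) φ_h′(τ)` with `φ_h′(τ) ∼ ½ log γ_n`, i.e.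
`δ_n = (γ_{n+1} − γ_n)(1/2π) log(γ_n/2π) → 1`; hence for every `ε` all but finitely many zeros have their next
`k` normalised spacings within `ε` of `1`, while `N(T) → ∞`. The file proves exactly this, in three layers:

* **A–C (real analysis of a phase lattice).** For a `C¹` phase `Ψ` with `Ψ′ = v ≥ c > 0` and
  `|v(t) − ½ log|t|| ≤ η log|t|` eventually (every `η > 0`), the zero set `Z = {t : sin Ψ(t) = 0}` is locally
  finite, the next zero after `γ ∈ Z` is `Ψ⁻¹(Ψ(γ) + π)`, the count in `[−T, T]` tends to infinity, and the
  normalised spacing tends to `1` along `Z` (mean value theorem); whence `HasTrivialSpacingDistribution F k` for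
  any `F` whose critical zero ordinates are `Z` (`hasTrivialSpacingDistribution_of_phase`).
* **D (the phase of `ξ`).** For `W(t) = e^{iθ}ξ(½ + h + it)` (zero-free when the velocity
  `v(t) = Re ξ′/ξ(½ + h + it)` is positive), the polar form `W = |W| e^{i(arg W(0) + φ(t))}`, `φ = ∫₀ᵗ v`,
  identifies the critical zero ordinates of `A_{h,θ}`, `B_{h,θ}` with `cos(arg W(0) + φ) = 0`,
  `sin(arg W(0) + φ) = 0` (as in the proof of Theorem 3.1); a uniform lower bound for `v` comes from
  `v ∼ ½ log|t|` far out and compactness (`hasTrivialSpacingDistribution_diffXi_of_velocity`).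
* **E (the velocity).** `|Re ξ′/ξ(s) − ½ log(|Im s|/2π) − Re ζ′/ζ(s)| ≤ (2 Re s + |Re s − 1| + 2)/|Im s|`
  for `Re s > 0`, `|Im s| ≥ 1` (`abs_re_logDeriv_xi_sub_le`, from
  `logDeriv_riemannXi_eq_add_logDeriv_riemannZeta`, `logDeriv_Gammaℝ` and the vertical Stirling bound
  `Literature.Analysis.SpecialFunctions.Complex.abs_re_digamma_sub_log_norm_le`); (4.5): `|ζ′/ζ|` on
  `[T, T+1]` is dominated by `R_h(T) = zetaLogDerivSup h T` (`norm_logDeriv_zeta_le_zetaLogDerivSup`), and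
  `R_h = o(log T)` gives `|v(t) − ½ log|t|| ≤ η log|t|` eventually (`abs_re_logDeriv_xi_sub_half_log_le`);
  `h < 0` reduces to `−h > 0` by `A_{−h,θ} = A_{h,−θ}`, `B_{−h,θ} = −B_{h,−θ}`, which have the same
  critical zero ordinates (`hasTrivialSpacingDistribution_diffXi_of_abs`).

## References

* [Lagarias2005] J. C. Lagarias, Acta Arith. 120 (2005) 159–184 = arXiv:math/0601653 — Theorem 4.1 and its proof
  (arXiv pp. 8–9), Lemma 4.1, Theorem 3.1.
* [Titchmarsh1986] E. C. Titchmarsh, *The Theory of the Riemann Zeta-Function*, 2nd ed., (5.17.4), Thm 14.5.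
-/

noncomputable section

open Complex Set MeasureTheory Filter Topology intervalIntegral Metric
open scoped Real ComplexConjugate Interval

namespace Literature.NumberTheory.LFunctions

namespace Lagarias2005Spacing

/-! ## A. Polar form of a non-vanishing `C¹` path (as in the Theorem 3.1 file) -/

/-- ODE uniqueness: a nowhere-vanishing `C¹` path `W : ℝ → ℂ` is `W(0) · exp(∫₀ᵗ W′/W)`. [folklore] -/
private theorem eq_mul_exp_integral_of_hasDerivAt {W W' : ℝ → ℂ} (hW : ∀ t, HasDerivAt W (W' t) t)
    (hW' : Continuous W') (h0 : ∀ t, W t ≠ 0) (t : ℝ) :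
    W t = W 0 * Complex.exp (∫ u in (0:ℝ)..t, W' u / W u) := by
  have hWc : Continuous W := continuous_iff_continuousAt.2 fun t ↦ (hW t).continuousAt
  have hq : Continuous fun u ↦ W' u / W u := hW'.div hWc h0
  have hL : ∀ t, HasDerivAt (fun t ↦ ∫ u in (0:ℝ)..t, W' u / W u) (W' t / W t) t := fun t ↦
    (hq.integral_hasStrictDerivAt 0 t).hasDerivAt
  have hQ : ∀ t, HasDerivAt (fun t ↦ W t * Complex.exp (-(∫ u in (0:ℝ)..t, W' u / W u))) 0 t := by
    intro t
    have h1 : HasDerivAt (fun s ↦ Complex.exp (-(∫ u in (0:ℝ)..s, W' u / W u)))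
        (Complex.exp (-(∫ u in (0:ℝ)..t, W' u / W u)) * -(W' t / W t)) t := ((hL t).neg).cexp
    have h2 : HasDerivAt (fun s ↦ W s * Complex.exp (-(∫ u in (0:ℝ)..s, W' u / W u)))
        (W' t * Complex.exp (-(∫ u in (0:ℝ)..t, W' u / W u)) +
          W t * (Complex.exp (-(∫ u in (0:ℝ)..t, W' u / W u)) * -(W' t / W t))) t := (hW t).mul h1
    have ht0 := h0 t
    have e : W' t * Complex.exp (-(∫ u in (0:ℝ)..t, W' u / W u)) +
        W t * (Complex.exp (-(∫ u in (0:ℝ)..t, W' u / W u)) * -(W' t / W t)) = 0 := by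
      field_simp
      ring
    rwa [e] at h2
  have hconst : ∀ t, W t * Complex.exp (-(∫ u in (0:ℝ)..t, W' u / W u)) = W 0 := by
    intro t
    have hd : Differentiable ℝ (fun t ↦ W t * Complex.exp (-(∫ u in (0:ℝ)..t, W' u / W u))) :=
      fun t ↦ (hQ t).differentiableAt
    have := is_const_of_deriv_eq_zero hd (fun t ↦ (hQ t).deriv) t 0
    simpa using this
  have h := hconst t
  calc W t = W t * Complex.exp (-(∫ u in (0:ℝ)..t, W' u / W u)) *
      Complex.exp (∫ u in (0:ℝ)..t, W' u / W u) := by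
        rw [mul_assoc, ← Complex.exp_add, neg_add_cancel, Complex.exp_zero, mul_one]
    _ = W 0 * Complex.exp (∫ u in (0:ℝ)..t, W' u / W u) := by rw [h]

/-- Polar decomposition of a nowhere-vanishing `C¹` path: with `Φ(t) = arg W(0) + Im ∫₀ᵗ W′/W`,
`Re W(t) = ‖W(t)‖ cos Φ(t)` and `Im W(t) = ‖W(t)‖ sin Φ(t)`. [folklore] -/
private theorem re_im_eq_norm_mul_of_hasDerivAt {W W' : ℝ → ℂ} (hW : ∀ t, HasDerivAt W (W' t) t)
    (hW' : Continuous W') (h0 : ∀ t, W t ≠ 0) (t : ℝ) :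
    (W t).re = ‖W t‖ * Real.cos (arg (W 0) + (∫ u in (0:ℝ)..t, W' u / W u).im) ∧
      (W t).im = ‖W t‖ * Real.sin (arg (W 0) + (∫ u in (0:ℝ)..t, W' u / W u).im) := by
  set L : ℂ := ∫ u in (0:ℝ)..t, W' u / W u with hL
  have hpol : W 0 = ‖W 0‖ * Complex.exp (arg (W 0) * I) := (Complex.norm_mul_exp_arg_mul_I (W 0)).symm
  have key : W t = ‖W 0‖ * Complex.exp (arg (W 0) * I + L) := by
    rw [eq_mul_exp_integral_of_hasDerivAt hW hW' h0 t, ← hL, Complex.exp_add, ← mul_assoc, ← hpol]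
  have hnorm : ‖W t‖ = ‖W 0‖ * Real.exp L.re := by
    rw [key, norm_mul, Complex.norm_real, Real.norm_eq_abs, abs_norm, Complex.norm_exp]
    simp
  have hre : (arg (W 0) * I + L).re = L.re := by simp
  have him : (arg (W 0) * I + L).im = arg (W 0) + L.im := by simp
  constructor
  · rw [hnorm]
    conv_lhs => rw [key]
    rw [Complex.re_ofReal_mul, Complex.exp_re, hre, him]; ring
  · rw [hnorm]
    conv_lhs => rw [key]
    rw [Complex.im_ofReal_mul, Complex.exp_im, hre, him]; ring

/-- Zero criteria in polar form: `Re W(t) = 0 ⟺ cos Φ(t) = 0` and `Im W(t) = 0 ⟺ sin Φ(t) = 0`. [folklore] -/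
private theorem re_eq_zero_iff_cos_of_hasDerivAt {W W' : ℝ → ℂ} (hW : ∀ t, HasDerivAt W (W' t) t)
    (hW' : Continuous W') (h0 : ∀ t, W t ≠ 0) (t : ℝ) :
    ((W t).re = 0 ↔ Real.cos (arg (W 0) + (∫ u in (0:ℝ)..t, W' u / W u).im) = 0) ∧
      ((W t).im = 0 ↔ Real.sin (arg (W 0) + (∫ u in (0:ℝ)..t, W' u / W u).im) = 0) := by
  obtain ⟨h1, h2⟩ := re_im_eq_norm_mul_of_hasDerivAt hW hW' h0 t
  have hn : ‖W t‖ ≠ 0 := norm_ne_zero_iff.2 (h0 t)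
  constructor
  · rw [h1]; exact ⟨fun h ↦ (mul_eq_zero.1 h).resolve_left hn, fun h ↦ by rw [h, mul_zero]⟩
  · rw [h2]; exact ⟨fun h ↦ (mul_eq_zero.1 h).resolve_left hn, fun h ↦ by rw [h, mul_zero]⟩

/-- Imaginary part of an interval integral (integrable version). [folklore] -/
private theorem im_intervalIntegral_eq {q : ℝ → ℂ} {a b : ℝ} (hq : IntervalIntegrable q volume a b) :
    (∫ u in a..b, q u).im = ∫ u in a..b, (q u).im := by
  have hcomm := ContinuousLinearMap.intervalIntegral_comp_comm (𝕜 := ℝ) imCLM hq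
  simpa only [imCLM_apply] using hcomm.symm

/-! ## B. Lattice points and sine zeros along a monotone phase (as in the Theorem 3.1 file) -/

/-- The integers `k` with `a ≤ kπ ≤ b` are those in `[⌈a/π⌉, ⌊b/π⌋]`. [folklore] -/
private theorem setOf_int_mul_pi_mem_eq (a b : ℝ) :
    {k : ℤ | a ≤ (k : ℝ) * π ∧ (k : ℝ) * π ≤ b} = ↑(Finset.Icc ⌈a / π⌉ ⌊b / π⌋) := by
  ext k
  simp only [mem_setOf_eq, Finset.coe_Icc, mem_Icc, Int.ceil_le, Int.le_floor]
  rw [div_le_iff₀ Real.pi_pos, le_div_iff₀ Real.pi_pos]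

/-- For `a ≤ b` the number `n` of integers `k` with `a ≤ kπ ≤ b` satisfies `|n − (b − a)/π| ≤ 1`. [folklore] -/
private theorem abs_ncard_int_mul_pi_mem_sub_le {a b : ℝ} (hab : a ≤ b) :
    |(({k : ℤ | a ≤ (k : ℝ) * π ∧ (k : ℝ) * π ≤ b}.ncard : ℕ) : ℝ) - (b - a) / π| ≤ 1 := by
  rw [setOf_int_mul_pi_mem_eq, Set.ncard_coe_finset, Int.card_Icc]
  have hπ := Real.pi_pos
  have hab' : a / π ≤ b / π := div_le_div_of_nonneg_right hab hπ.le
  have e : (b - a) / π = b / π - a / π := by ring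
  rw [e]
  set a' := a / π
  set b' := b / π
  have h1 : (⌈a'⌉ : ℝ) < a' + 1 := Int.ceil_lt_add_one a'
  have h2 : a' ≤ (⌈a'⌉ : ℝ) := Int.le_ceil a'
  have h3 : (⌊b'⌋ : ℝ) ≤ b' := Int.floor_le b'
  have h4 : b' < (⌊b'⌋ : ℝ) + 1 := Int.lt_floor_add_one b'
  rcases le_or_gt ⌈a'⌉ ⌊b'⌋ with hle | hgt
  · have hnn : 0 ≤ ⌊b'⌋ + 1 - ⌈a'⌉ := by omega
    rw [show (((⌊b'⌋ + 1 - ⌈a'⌉).toNat : ℕ) : ℝ) = ((⌊b'⌋ + 1 - ⌈a'⌉ : ℤ) : ℝ) by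
      exact_mod_cast Int.toNat_of_nonneg hnn]
    push_cast
    rw [abs_le]
    constructor <;> linarith
  · have hz : (⌊b'⌋ + 1 - ⌈a'⌉).toNat = 0 := by
      rw [Int.toNat_eq_zero]; omega
    rw [hz]
    have hgt' : (⌊b'⌋ : ℝ) + 1 ≤ ⌈a'⌉ := by exact_mod_cast hgt
    rw [abs_le]
    push_cast
    constructor <;> linarith

/-- Counting sine zeros along a strictly increasing continuous phase on `[t₁, t₂]`: they are finitely many and
their number `n` satisfies `|n − (Ψ(t₂) − Ψ(t₁))/π| ≤ 1`. [folklore] -/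
private theorem finite_and_abs_ncard_sin_zero_sub_le {Ψ : ℝ → ℝ} {t₁ t₂ : ℝ} (h12 : t₁ ≤ t₂)
    (hc : ContinuousOn Ψ (Icc t₁ t₂)) (hm : StrictMonoOn Ψ (Icc t₁ t₂)) :
    {t : ℝ | t ∈ Icc t₁ t₂ ∧ Real.sin (Ψ t) = 0}.Finite ∧
      |(({t : ℝ | t ∈ Icc t₁ t₂ ∧ Real.sin (Ψ t) = 0}.ncard : ℕ) : ℝ) - (Ψ t₂ - Ψ t₁) / π| ≤ 1 := by
  set S := {t : ℝ | t ∈ Icc t₁ t₂ ∧ Real.sin (Ψ t) = 0} with hS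
  set K := {k : ℤ | Ψ t₁ ≤ (k : ℝ) * π ∧ (k : ℝ) * π ≤ Ψ t₂} with hK
  set Z := {y : ℝ | y ∈ Icc (Ψ t₁) (Ψ t₂) ∧ Real.sin y = 0} with hZ
  have hinj : InjOn Ψ S := hm.injOn.mono fun t ht ↦ ht.1
  have himage : Ψ '' S = Z := by
    apply Subset.antisymm
    · rintro _ ⟨t, ⟨ht, hsin⟩, rfl⟩
      exact ⟨⟨hm.monotoneOn (left_mem_Icc.2 h12) ht ht.1, hm.monotoneOn ht (right_mem_Icc.2 h12) ht.2⟩, hsin⟩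
    · rintro y ⟨hy, hsin⟩
      obtain ⟨t, ht, rfl⟩ := intermediate_value_Icc h12 hc hy
      exact ⟨t, ⟨ht, hsin⟩, rfl⟩
  have hZK : Z = (fun k : ℤ ↦ (k : ℝ) * π) '' K := by
    ext y
    constructor
    · rintro ⟨hy, hsin⟩
      obtain ⟨k, hk⟩ := Real.sin_eq_zero_iff.1 hsin
      refine ⟨k, ⟨?_, ?_⟩, hk⟩ <;> rw [hk] <;> [exact hy.1; exact hy.2]
    · rintro ⟨k, ⟨hk1, hk2⟩, rfl⟩
      exact ⟨⟨hk1, hk2⟩, Real.sin_eq_zero_iff.2 ⟨k, rfl⟩⟩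
  have hKfin : K.Finite := by
    rw [hK, setOf_int_mul_pi_mem_eq]; exact Finset.finite_toSet _
  have hmul_inj : Function.Injective (fun k : ℤ ↦ (k : ℝ) * π) := fun k₁ k₂ h ↦ by
    have := mul_right_cancel₀ Real.pi_pos.ne' h
    exact_mod_cast this
  have hZfin : Z.Finite := by rw [hZK]; exact hKfin.image _
  have hSfin : S.Finite := Set.Finite.of_finite_image (by rw [himage]; exact hZfin) hinj
  refine ⟨hSfin, ?_⟩
  have hcard : S.ncard = K.ncard := by
    rw [← hinj.ncard_image, himage, hZK, Set.ncard_image_of_injective _ hmul_inj]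
  rw [hcard]
  exact abs_ncard_int_mul_pi_mem_sub_le (hm.monotoneOn (left_mem_Icc.2 h12) (right_mem_Icc.2 h12) h12)

/-! ## C. The zero lattice of a phase with velocity `≥ c > 0` and `∼ ½ log|t|` -/

section Phase

variable {Ψ v : ℝ → ℝ} (hΨ : ∀ t, HasDerivAt Ψ (v t) t) {c : ℝ} (hc : 0 < c) (hcv : ∀ t, c ≤ v t)
include hΨ hc hcv

/-- The phase is strictly increasing. [folklore] -/
private theorem phase_strictMono : StrictMono Ψ :=
  strictMono_of_deriv_pos fun t ↦ by rw [(hΨ t).deriv]; exact lt_of_lt_of_le hc (hcv t)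

omit hc hcv in
/-- The phase is continuous. [folklore] -/
private theorem phase_continuous : Continuous Ψ :=
  continuous_iff_continuousAt.2 fun t ↦ (hΨ t).continuousAt

omit hc in
/-- Growth of the phase: `Ψ(b) − Ψ(a) ≥ c (b − a)` for `a ≤ b` (mean value theorem). [folklore] -/
private theorem phase_sub_ge {a b : ℝ} (hab : a ≤ b) : c * (b - a) ≤ Ψ b - Ψ a := by
  rcases hab.eq_or_lt with rfl | hlt
  · simp
  · obtain ⟨ξ, -, hξ⟩ := exists_hasDerivAt_eq_slope Ψ v hlt
      ((phase_continuous hΨ).continuousOn) (fun x _ ↦ hΨ x)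
    have hba : 0 < b - a := by linarith
    have := hcv ξ
    rw [hξ, le_div_iff₀ hba] at this
    linarith

/-- The phase is onto `ℝ`. [folklore] -/
private theorem phase_surjective : Function.Surjective Ψ := by
  have hcont := phase_continuous hΨ
  refine hcont.surjective ?_ ?_
  · refine tendsto_atTop_mono' atTop ?_
      (tendsto_atTop_add_const_left atTop (Ψ 0) (tendsto_id.const_mul_atTop hc))
    filter_upwards [eventually_ge_atTop (0 : ℝ)] with t ht
    have := phase_sub_ge hΨ hcv ht
    simp only [id]
    linarith
  · refine tendsto_atBot_mono' atBot ?_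
      (tendsto_atBot_add_const_left atBot (Ψ 0) (tendsto_id.const_mul_atBot hc))
    filter_upwards [eventually_le_atBot (0 : ℝ)] with t ht
    have := phase_sub_ge hΨ hcv ht
    simp only [id]
    linarith

/-- **The next zero.** If `sin Ψ(γ) = 0`, the least `u > γ` with `sin Ψ(u) = 0` is the unique `γ⁺` with
`Ψ(γ⁺) = Ψ(γ) + π`. [folklore] -/
private theorem isLeast_nextZero {γ γ' : ℝ} (hγ : Real.sin (Ψ γ) = 0) (hγ' : Ψ γ' = Ψ γ + π) :
    IsLeast {u : ℝ | Real.sin (Ψ u) = 0 ∧ γ < u} γ' := by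
  have hmono := phase_strictMono hΨ hc hcv
  obtain ⟨k, hk⟩ := Real.sin_eq_zero_iff.1 hγ
  refine ⟨⟨?_, ?_⟩, fun u ⟨hu, hγu⟩ ↦ ?_⟩
  · rw [hγ', ← hk]
    exact Real.sin_eq_zero_iff.2 ⟨k + 1, by push_cast; ring⟩
  · exact hmono.lt_iff_lt.1 (by rw [hγ']; linarith [Real.pi_pos])
  · obtain ⟨m, hm⟩ := Real.sin_eq_zero_iff.1 hu
    have hlt : Ψ γ < Ψ u := hmono hγu
    rw [← hk, ← hm] at hlt
    have hkm : k < m := by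
      by_contra h
      push Not at h
      have : (m : ℝ) * π ≤ (k : ℝ) * π := by
        exact mul_le_mul_of_nonneg_right (by exact_mod_cast h) Real.pi_pos.le
      linarith
    have hkm' : (k : ℝ) + 1 ≤ m := by exact_mod_cast hkm
    have hge : Ψ γ' ≤ Ψ u := by
      rw [hγ', ← hk, ← hm]
      nlinarith [Real.pi_pos]
    exact hmono.le_iff_le.1 hge

/-- The next zero as an `sInf`, with its three properties: it is a zero, it is larger, and the phase advances by
exactly `π`. [folklore] -/
private theorem exists_nextZero {γ : ℝ} (hγ : Real.sin (Ψ γ) = 0) :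
    ∃ γ' : ℝ, sInf {u : ℝ | Real.sin (Ψ u) = 0 ∧ γ < u} = γ' ∧ Real.sin (Ψ γ') = 0 ∧ γ < γ' ∧
      Ψ γ' = Ψ γ + π := by
  obtain ⟨γ', hγ'⟩ := phase_surjective hΨ hc hcv (Ψ γ + π)
  have hL := isLeast_nextZero hΨ hc hcv hγ hγ'
  exact ⟨γ', hL.csInf_eq, hL.1.1, hL.1.2, hγ'⟩

/-- Gap bound: the next zero is at distance `≤ π/c`. [folklore] -/
private theorem nextZero_sub_le {γ γ' : ℝ} (hlt : γ ≤ γ') (hγ' : Ψ γ' = Ψ γ + π) : γ' - γ ≤ π / c := by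
  have h := phase_sub_ge hΨ hcv hlt
  rw [hγ'] at h
  rw [le_div_iff₀ hc]
  linarith

omit hc hcv in
/-- Mean value form of the gap: `π = v(τ) (γ⁺ − γ)` for some `τ` strictly between. [folklore] -/
private theorem exists_gap_eq {γ γ' : ℝ} (hlt : γ < γ') (hγ' : Ψ γ' = Ψ γ + π) :
    ∃ τ ∈ Ioo γ γ', π = v τ * (γ' - γ) := by
  obtain ⟨τ, hτ, hτ'⟩ := exists_hasDerivAt_eq_slope Ψ v hlt ((phase_continuous hΨ).continuousOn)
    (fun x _ ↦ hΨ x)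
  refine ⟨τ, hτ, ?_⟩
  rw [hτ', hγ', div_mul_cancel₀ _ (by linarith : γ' - γ ≠ 0)]
  ring

/-- Local finiteness and the lattice count: on `[a, b]` the zeros of `sin Ψ` are finitely many, at least
`(Ψ(b) − Ψ(a))/π − 1` of them. [folklore] -/
private theorem finite_zeros_Icc (a b : ℝ) (hab : a ≤ b) :
    {t : ℝ | t ∈ Icc a b ∧ Real.sin (Ψ t) = 0}.Finite ∧
      (Ψ b - Ψ a) / π - 1 ≤ (({t : ℝ | t ∈ Icc a b ∧ Real.sin (Ψ t) = 0}.ncard : ℕ) : ℝ) := by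
  obtain ⟨hfin, habs⟩ := finite_and_abs_ncard_sin_zero_sub_le hab ((phase_continuous hΨ).continuousOn)
    ((phase_strictMono hΨ hc hcv).strictMonoOn _)
  exact ⟨hfin, by linarith [(abs_le.1 habs).1]⟩

/-- The zeros of `sin Ψ` in any bounded set are finitely many. [folklore] -/
private theorem finite_zeros_of_bounded {S : Set ℝ} {a b : ℝ} (hS : S ⊆ Icc a b) :
    {t : ℝ | Real.sin (Ψ t) = 0 ∧ t ∈ S}.Finite := by
  rcases le_or_gt a b with hab | hab
  · exact (finite_zeros_Icc hΨ hc hcv a b hab).1.subset fun t ⟨ht, htS⟩ ↦ ⟨hS htS, ht⟩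
  · have : S = ∅ := Set.eq_empty_of_subset_empty fun t ht ↦ by
      have := hS ht; rw [Icc_eq_empty (not_le.2 hab)] at this; exact this
    subst this
    simp

/-- The number of zeros with `|t| ≤ T` tends to infinity. [folklore] -/
private theorem tendsto_ncard_zeros_atTop :
    Tendsto (fun T : ℝ ↦ (({t : ℝ | Real.sin (Ψ t) = 0 ∧ |t| ≤ T}.ncard : ℕ) : ℝ)) atTop atTop := by
  have hlow : ∀ T : ℝ, 0 ≤ T → c * T / π - 1 ≤ (({t : ℝ | Real.sin (Ψ t) = 0 ∧ |t| ≤ T}.ncard : ℕ) : ℝ) := by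
    intro T hT
    obtain ⟨hfin, hcount⟩ := finite_zeros_Icc hΨ hc hcv 0 T hT
    have hsub : {t : ℝ | t ∈ Icc 0 T ∧ Real.sin (Ψ t) = 0} ⊆ {t : ℝ | Real.sin (Ψ t) = 0 ∧ |t| ≤ T} := by
      rintro t ⟨⟨h0, hT'⟩, hs⟩
      exact ⟨hs, by rw [abs_of_nonneg h0]; exact hT'⟩
    have hfin' : {t : ℝ | Real.sin (Ψ t) = 0 ∧ |t| ≤ T}.Finite :=
      (finite_zeros_of_bounded hΨ hc hcv (S := Icc (-T) T) (a := -T) (b := T) Subset.rfl).subset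
        fun t ht ↦ ⟨ht.1, abs_le.1 ht.2⟩
    have hmono : ({t : ℝ | t ∈ Icc 0 T ∧ Real.sin (Ψ t) = 0}.ncard : ℝ) ≤
        ({t : ℝ | Real.sin (Ψ t) = 0 ∧ |t| ≤ T}.ncard : ℝ) := by
      exact_mod_cast Set.ncard_le_ncard hsub hfin'
    have hg := phase_sub_ge hΨ hcv hT
    have : c * T / π ≤ (Ψ T - Ψ 0) / π := by
      rw [div_le_div_iff_of_pos_right Real.pi_pos]; linarith
    linarith
  refine tendsto_atTop_mono' atTop ?_
    ((tendsto_atTop_add_const_right atTop (-1) ((tendsto_id.const_mul_atTop hc).atTop_div_const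
      Real.pi_pos)))
  filter_upwards [eventually_ge_atTop (0 : ℝ)] with T hT
  have := hlow T hT
  simp only [id]
  linarith

/-- **The normalised spacing tends to `1` along the zero lattice.** If moreover
`|v(t) − ½ log|t|| ≤ η log|t|` for `|t| ≥ T₀(η)`, for every `η > 0`, then for every `ε > 0` there is `T₁` such
that every zero `γ` of `sin Ψ` with `|γ| ≥ T₁` and its successor `γ⁺` (`Ψ(γ⁺) = Ψ(γ) + π`) satisfy
`|(γ⁺ − γ)(1/2π) log(|γ|/2π) − 1| < ε` — the computation `δ_n = log(γ_n/2π)/(2 φ′(τ))`, `φ′(τ) ∼ ½ log γ_n`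
of the printed proof. [cite: Lagarias2005, Theorem 4.1, proof (arXiv pp. 8–9; held text p0008:L89–p0009)] -/
theorem exists_spacing_near_one
    (hv : ∀ η : ℝ, 0 < η → ∃ T₀ : ℝ, ∀ t : ℝ, T₀ ≤ |t| → |v t - 1 / 2 * Real.log (|t|)| ≤ η * Real.log |t|)
    {ε : ℝ} (hε : 0 < ε) :
    ∃ T₁ : ℝ, ∀ γ γ' : ℝ, T₁ ≤ |γ| → γ < γ' → Ψ γ' = Ψ γ + π →
      |(γ' - γ) * (1 / (2 * π)) * Real.log (|γ| / (2 * π)) - 1| < ε := by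
  -- constants
  set A : ℝ := 4 / 3 * (1 + Real.log (2 * π)) with hA
  have hlog2π : 0 < Real.log (2 * π) := Real.log_pos (by linarith [Real.pi_gt_three])
  have hA0 : 0 < A := by rw [hA]; positivity
  set ε' : ℝ := min ε 1 with hε'
  have hε'0 : 0 < ε' := lt_min hε one_pos
  have hε'1 : ε' ≤ 1 := min_le_right _ _
  have hε'ε : ε' ≤ ε := min_le_left _ _
  set η : ℝ := ε' / 8 with hη
  have hη0 : 0 < η := by positivity
  obtain ⟨T₀, hT₀⟩ := hv η hη0
  set G : ℝ := π / c with hG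
  have hG0 : 0 < G := div_pos Real.pi_pos hc
  refine ⟨max (max T₀ 1 + G) (max (2 * G + 1) (Real.exp (4 * A / ε') + G)), ?_⟩
  intro γ γ' hγ hlt hΨ'
  have hT₁a : max T₀ 1 + G ≤ |γ| := le_trans (le_max_left _ _) hγ
  have hT₁b : 2 * G + 1 ≤ |γ| := le_trans ((le_max_left _ _).trans (le_max_right _ _)) hγ
  have hT₁c : Real.exp (4 * A / ε') + G ≤ |γ| := le_trans ((le_max_right _ _).trans (le_max_right _ _)) hγ
  -- the gap and the intermediate point
  have hgap : γ' - γ ≤ G := nextZero_sub_le hΨ hc hcv hlt.le hΨ'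
  obtain ⟨τ, hτ, hπ⟩ := exists_gap_eq hΨ hlt hΨ'
  have hτγ : |τ - γ| ≤ G := by
    rw [abs_le]; constructor <;> linarith [hτ.1, hτ.2]
  have habsτ : |γ| - G ≤ |τ| := by
    have := abs_sub_abs_le_abs_sub γ τ
    rw [abs_sub_comm] at this
    linarith
  have habsτ' : |τ| ≤ |γ| + G := by
    have := abs_sub_abs_le_abs_sub τ γ
    linarith
  have hτT₀ : T₀ ≤ |τ| := by linarith [le_max_left T₀ 1]
  have hτ1 : 1 ≤ |τ| := by linarith [le_max_right T₀ 1]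
  have hγ1 : 1 ≤ |γ| := by linarith [le_max_right T₀ 1]
  have hγpos : 0 < |γ| := by linarith
  have hτpos : 0 < |τ| := by linarith
  -- the velocity at `τ`
  have hvτ := hT₀ τ hτT₀
  have hlogτ : 4 * A / ε' ≤ Real.log |τ| := by
    have : Real.exp (4 * A / ε') ≤ |τ| := by linarith
    have := Real.log_le_log (Real.exp_pos _) this
    rwa [Real.log_exp] at this
  have hAε : 0 < 4 * A / ε' := by positivity
  have hlogτ0 : 0 < Real.log |τ| := lt_of_lt_of_le hAε hlogτ
  have hη18 : η ≤ 1 / 8 := by rw [hη]; linarith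
  have hvlow : (1 / 2 - η) * Real.log |τ| ≤ v τ := by
    have := (abs_le.1 hvτ).1; linarith
  have hvpos : 0 < v τ := by
    have : 0 < (1 / 2 - η) * Real.log |τ| := mul_pos (by linarith) hlogτ0
    linarith
  -- `δ = log(|γ|/2π) / (2 v τ)`
  have hgap_eq : γ' - γ = π / v τ := by
    rw [eq_div_iff hvpos.ne']; linarith [hπ]
  have hδ : (γ' - γ) * (1 / (2 * π)) * Real.log (|γ| / (2 * π)) =
      Real.log (|γ| / (2 * π)) / (2 * v τ) := by
    rw [hgap_eq]; field_simp
  rw [hδ]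
  -- `|log|γ| − log|τ|| ≤ 1`
  have hlogdiff : |Real.log |γ| - Real.log (|τ|)| ≤ 1 := by
    have hmin : G + 1 ≤ min |γ| |τ| := le_min (by linarith) (by linarith)
    have h1 : Real.log |γ| - Real.log |τ| ≤ (|γ| - |τ|) / |τ| := by
      rw [← Real.log_div hγpos.ne' hτpos.ne']
      have := Real.log_le_sub_one_of_pos (div_pos hγpos hτpos)
      rw [div_sub_one hτpos.ne'] at this
      exact this
    have h2 : Real.log |τ| - Real.log |γ| ≤ (|τ| - |γ|) / |γ| := by
      rw [← Real.log_div hτpos.ne' hγpos.ne']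
      have := Real.log_le_sub_one_of_pos (div_pos hτpos hγpos)
      rw [div_sub_one hγpos.ne'] at this
      exact this
    have h3 : (|γ| - |τ|) / |τ| ≤ 1 := by
      rw [div_le_one hτpos]; linarith
    have h4 : (|τ| - |γ|) / |γ| ≤ 1 := by
      rw [div_le_one hγpos]; linarith
    rw [abs_le]; constructor <;> linarith
  -- the main estimate
  have h2v : 3 / 4 * Real.log |τ| ≤ 2 * v τ := by
    have : 3 / 8 * Real.log |τ| ≤ (1 / 2 - η) * Real.log |τ| :=
      mul_le_mul_of_nonneg_right (by linarith) hlogτ0.le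
    linarith
  have h2v0 : 0 < 2 * v τ := by linarith
  have hnum : |Real.log (|γ| / (2 * π)) - 2 * v τ| ≤
      1 + Real.log (2 * π) + 2 * η * Real.log |τ| := by
    rw [Real.log_div hγpos.ne' (by positivity)]
    have e : Real.log |γ| - Real.log (2 * π) - 2 * v τ =
        (Real.log |γ| - Real.log |τ|) - Real.log (2 * π) - 2 * (v τ - 1 / 2 * Real.log |τ|) := by ring
    rw [e]
    have a1 := abs_le.1 hlogdiff
    have a2 := abs_le.1 hvτ
    rw [abs_le]; constructor <;> linarith
  have hkey : |Real.log (|γ| / (2 * π)) / (2 * v τ) - 1| =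
      |Real.log (|γ| / (2 * π)) - 2 * v τ| / (2 * v τ) := by
    rw [div_sub_one h2v0.ne', abs_div, abs_of_pos h2v0]
  rw [hkey, div_lt_iff₀ h2v0]
  -- `1 + log 2π = (3/4) A ≤ (ε'/4) (2 v τ)` and `2η log|τ| ≤ (ε'/2) (2 v τ)`
  have hAlog : 4 * A ≤ Real.log |τ| * ε' := (div_le_iff₀ hε'0).1 hlogτ
  have hm1 : ε' / 4 * (3 / 4 * Real.log |τ|) ≤ ε' / 4 * (2 * v τ) :=
    mul_le_mul_of_nonneg_left h2v (by positivity)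
  have hstep1 : 1 + Real.log (2 * π) ≤ ε' / 4 * (2 * v τ) := by
    have e : 1 + Real.log (2 * π) = 3 / 4 * A := by rw [hA]; ring
    rw [e]
    linarith
  have hstep2 : 2 * η * Real.log |τ| ≤ ε' / 2 * (2 * v τ) := by
    rw [hη]
    have hpos : 0 < ε' * (2 * v τ) := mul_pos hε'0 h2v0
    have hnn : 0 ≤ ε' * Real.log |τ| := by positivity
    linarith
  have hεε : ε' * (2 * v τ) ≤ ε * (2 * v τ) := mul_le_mul_of_nonneg_right hε'ε h2v0.le
  have hpos' : 0 < ε' * (2 * v τ) := mul_pos hε'0 h2v0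
  calc |Real.log (|γ| / (2 * π)) - 2 * v τ| ≤ 1 + Real.log (2 * π) + 2 * η * Real.log |τ| := hnum
    _ ≤ ε' / 4 * (2 * v τ) + ε' / 2 * (2 * v τ) := add_le_add hstep1 hstep2
    _ < ε * (2 * v τ) := by linarith

end Phase

/-! ## C'. From the zero lattice to `HasTrivialSpacingDistribution` -/

/-- `HasTrivialSpacingDistribution` depends on `F` only through its set of critical zero ordinates.
[cite: Lagarias2005, §4 p.8 (definition of the limiting spacing distribution)] -/
theorem hasTrivialSpacingDistribution_congr {F G : ℂ → ℂ} (hFG : critZeroOrdinates F = critZeroOrdinates G)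
    (k : ℕ) : HasTrivialSpacingDistribution F k ↔ HasTrivialSpacingDistribution G k := by
  have hnext : nextCritZero F = nextCritZero G := by
    funext t; simp only [nextCritZero, hFG]
  have hnorm : normZeroSpacing F = normZeroSpacing G := by
    funext t; simp only [normZeroSpacing, hnext]
  simp only [HasTrivialSpacingDistribution, hFG, hnext, hnorm]

/-- **From the phase lattice to the trivial spacing distribution.** If the critical zero ordinates of `F` are
exactly the zeros of `sin Ψ` for a phase `Ψ` as in section C (velocity `≥ c > 0` and `∼ ½ log|t|`), then for
every `k` the `k` consecutive normalised spacings of `F` have the trivial limiting distribution: the exceptional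
zeros lie in a bounded window (finitely many), while the total count tends to infinity.
[cite: Lagarias2005, Theorem 4.1, proof (arXiv pp. 8–9; held text p0008:L89–p0009)] -/
theorem hasTrivialSpacingDistribution_of_phase {Ψ v : ℝ → ℝ} (hΨ : ∀ t, HasDerivAt Ψ (v t) t) {c : ℝ}
    (hc : 0 < c) (hcv : ∀ t, c ≤ v t)
    (hv : ∀ η : ℝ, 0 < η → ∃ T₀ : ℝ, ∀ t : ℝ, T₀ ≤ |t| → |v t - 1 / 2 * Real.log (|t|)| ≤ η * Real.log |t|)
    {F : ℂ → ℂ} (hZ : ∀ t : ℝ, t ∈ critZeroOrdinates F ↔ Real.sin (Ψ t) = 0) (k : ℕ) :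
    HasTrivialSpacingDistribution F k := by
  intro ε hε
  -- the next zero of `F` is the next lattice point
  have hnext : ∀ γ : ℝ, Real.sin (Ψ γ) = 0 →
      Real.sin (Ψ (nextCritZero F γ)) = 0 ∧ γ < nextCritZero F γ ∧ Ψ (nextCritZero F γ) = Ψ γ + π := by
    intro γ hγ
    obtain ⟨γ', hinf, h1, h2, h3⟩ := exists_nextZero hΨ hc hcv hγ
    have hset : {u : ℝ | u ∈ critZeroOrdinates F ∧ γ < u} = {u : ℝ | Real.sin (Ψ u) = 0 ∧ γ < u} := by
      ext u; simp only [mem_setOf_eq, hZ]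
    have hn : nextCritZero F γ = γ' := by rw [nextCritZero, hset, hinf]
    rw [hn]; exact ⟨h1, h2, h3⟩
  set G : ℝ := π / c with hG
  have hG0 : 0 < G := div_pos Real.pi_pos hc
  obtain ⟨T₁, hT₁⟩ := exists_spacing_near_one hΨ hc hcv hv hε
  -- iterates of `nextCritZero` starting from a zero with `γ ≥ T₁` or `γ ≤ −(T₁ + k G)` stay good
  have hgood_pos : ∀ j : ℕ, ∀ γ : ℝ, Real.sin (Ψ γ) = 0 → max T₁ 0 ≤ γ →
      Real.sin (Ψ ((nextCritZero F)^[j] γ)) = 0 ∧ max T₁ 0 ≤ (nextCritZero F)^[j] γ := by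
    intro j
    induction j with
    | zero => intro γ hγ hγT; exact ⟨hγ, hγT⟩
    | succ j ih =>
      intro γ hγ hγT
      obtain ⟨h1, h2⟩ := ih γ hγ hγT
      rw [Function.iterate_succ_apply']
      obtain ⟨hz, hlt, -⟩ := hnext _ h1
      exact ⟨hz, by linarith⟩
  have hgood_neg : ∀ j : ℕ, ∀ γ : ℝ, Real.sin (Ψ γ) = 0 → γ ≤ -(max T₁ 0 + k * G) → j ≤ k →
      Real.sin (Ψ ((nextCritZero F)^[j] γ)) = 0 ∧ (nextCritZero F)^[j] γ ≤ -(max T₁ 0 + k * G) + j * G := by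
    intro j
    induction j with
    | zero => intro γ hγ hγT _; exact ⟨hγ, by simpa using hγT⟩
    | succ j ih =>
      intro γ hγ hγT hjk
      obtain ⟨h1, h2⟩ := ih γ hγ hγT (by omega)
      rw [Function.iterate_succ_apply']
      obtain ⟨hz, hlt, hπ⟩ := hnext _ h1
      have hgap := nextZero_sub_le hΨ hc hcv hlt.le hπ
      refine ⟨hz, ?_⟩
      push_cast
      linarith
  -- hence the exceptional set is contained in a bounded window
  set Bad : ℝ → Set ℝ := fun T ↦ {t : ℝ | t ∈ critZeroOrdinates F ∧ |t| ≤ T ∧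
      ∃ j : ℕ, j < k ∧ ε ≤ |normZeroSpacing F ((nextCritZero F)^[j] t) - 1|} with hBad
  set W : Set ℝ := {t : ℝ | Real.sin (Ψ t) = 0 ∧ t ∈ Icc (-(max T₁ 0 + k * G)) (max T₁ 0)} with hW
  have hWfin : W.Finite :=
    (finite_zeros_of_bounded hΨ hc hcv (S := Icc (-(max T₁ 0 + k * G)) (max T₁ 0))
      (a := -(max T₁ 0 + k * G)) (b := max T₁ 0) Subset.rfl).subset fun t ht ↦ ⟨ht.1, ht.2⟩
  have hgoodspacing : ∀ γ : ℝ, Real.sin (Ψ γ) = 0 → T₁ ≤ |γ| → |normZeroSpacing F γ - 1| < ε := by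
    intro γ hγ hγT
    obtain ⟨-, hlt, hπ⟩ := hnext γ hγ
    exact hT₁ γ _ hγT hlt hπ
  have hBadW : ∀ T, Bad T ⊆ W := by
    intro T t ht
    obtain ⟨htZ, -, j, hjk, hbad⟩ := ht
    have hsin : Real.sin (Ψ t) = 0 := (hZ t).1 htZ
    refine ⟨hsin, ?_, ?_⟩
    · -- `t > -(max T₁ 0 + kG)` would be fine; suppose `t ≤ -(…)`: then all iterates are good
      by_contra hlt
      push Not at hlt
      obtain ⟨hzj, hle⟩ := hgood_neg j t hsin hlt.le hjk.le
      have hj1 : (j : ℝ) + 1 ≤ k := by exact_mod_cast hjk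
      have hjG : ((j : ℝ) + 1) * G ≤ k * G := mul_le_mul_of_nonneg_right hj1 hG0.le
      have hM0 : 0 ≤ max T₁ 0 := le_max_right T₁ 0
      have hneg : (nextCritZero F)^[j] t ≤ -(max T₁ 0) - G := by linarith
      have habs : T₁ ≤ |(nextCritZero F)^[j] t| := by
        rw [abs_of_nonpos (by linarith)]
        linarith [le_max_left T₁ 0]
      exact absurd (hgoodspacing _ hzj habs) (not_lt.2 hbad)
    · by_contra hgt
      push Not at hgt
      obtain ⟨hzj, hge⟩ := hgood_pos j t hsin hgt.le
      have habs : T₁ ≤ |(nextCritZero F)^[j] t| := by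
        rw [abs_of_nonneg (le_trans (le_max_right _ _) hge)]
        exact le_trans (le_max_left _ _) hge
      exact absurd (hgoodspacing _ hzj habs) (not_lt.2 hbad)
  -- the total count tends to infinity
  have htot := tendsto_ncard_zeros_atTop hΨ hc hcv
  have hset : ∀ T, {t : ℝ | t ∈ critZeroOrdinates F ∧ |t| ≤ T} = {t : ℝ | Real.sin (Ψ t) = 0 ∧ |t| ≤ T} := by
    intro T; ext t; simp only [mem_setOf_eq, hZ]
  -- conclusion
  rw [Metric.tendsto_atTop]
  intro δ hδ
  obtain ⟨T₂, hT₂⟩ := (tendsto_atTop_atTop.1 htot) ((W.ncard : ℝ) / δ + 1)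
  refine ⟨T₂, fun T hT ↦ ?_⟩
  have hN := hT₂ T hT
  have hNpos : 0 < (({t : ℝ | Real.sin (Ψ t) = 0 ∧ |t| ≤ T}.ncard : ℕ) : ℝ) := by
    have : 0 ≤ (W.ncard : ℝ) / δ := by positivity
    linarith
  have hBadle : ((Bad T).ncard : ℝ) ≤ (W.ncard : ℝ) := by exact_mod_cast Set.ncard_le_ncard (hBadW T) hWfin
  rw [Real.dist_eq, sub_zero, hset T]
  show |(((Bad T).ncard : ℕ) : ℝ) / _| < δ
  rw [abs_of_nonneg (by positivity), div_lt_iff₀ hNpos]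
  calc ((Bad T).ncard : ℝ) ≤ W.ncard := hBadle
    _ < δ * ((W.ncard : ℝ) / δ + 1) := by rw [mul_add, mul_div_cancel₀ _ hδ.ne']; linarith
    _ ≤ δ * (({t : ℝ | Real.sin (Ψ t) = 0 ∧ |t| ≤ T}.ncard : ℕ) : ℝ) := by
        exact mul_le_mul_of_nonneg_left hN hδ.le

/-! ## D. The phase of `e^{iθ} ξ(½ + h + it)` and the zeros of `A_{h,θ}`, `B_{h,θ}` on the line -/

/-- **Theorem 4.1, core** (both parts): if the phase velocity `v(t) = Re ξ′/ξ(½ + h + it)` is positive for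
every `t` and `|v(t) − ½ log|t|| ≤ η log|t|` for `|t| ≥ T₀(η)`, every `η > 0`, then for every `θ` and every
`k` the `k` consecutive normalised zero spacings of `A_{h,θ}` and of `B_{h,θ}` have the trivial limiting
distribution. The zeros of `A_{h,θ}` (resp. `B_{h,θ}`) on the line are the solutions of
`cos(θ + φ_h(t)) = 0` (resp. `sin(θ + φ_h(t)) = 0`), `φ_h` the continuous phase of `ξ(½ + h + it)`, by the
polar form `e^{iθ}ξ(½ + h + it) = |ξ| e^{i(θ + φ_h(t))}` (proof of Theorem 3.1); the rest is section C.
[cite: Lagarias2005, Theorem 4.1, proof (arXiv pp. 8–9; held text p0008:L89–p0009)] -/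
theorem hasTrivialSpacingDistribution_diffXi_of_velocity {h : ℝ}
    (hpos : ∀ t : ℝ, 0 < (logDeriv riemannXi (1 / 2 + t * I + h)).re)
    (hv : ∀ η : ℝ, 0 < η → ∃ T₀ : ℝ, ∀ t : ℝ, T₀ ≤ |t| →
      |(logDeriv riemannXi (1 / 2 + t * I + h)).re - 1 / 2 * Real.log (|t|)| ≤ η * Real.log |t|)
    (θ : ℝ) (k : ℕ) :
    HasTrivialSpacingDistribution (diffXiArot h θ) k ∧ HasTrivialSpacingDistribution (diffXiBrot h θ) k := by
  set x : ℝ := 1 / 2 + h with hxdef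
  have hpt : ∀ t : ℝ, (1 / 2 : ℂ) + t * I + h = (x : ℂ) + t * I := fun t ↦ by
    rw [hxdef]; push_cast; ring
  -- the velocity `v(t) = Re ξ'/ξ(x + it)`
  obtain ⟨v, hvdef⟩ : ∃ v : ℝ → ℝ, v = fun t : ℝ ↦ (logDeriv riemannXi ((x : ℂ) + t * I)).re := ⟨_, rfl⟩
  have hvpt : ∀ t : ℝ, (logDeriv riemannXi (1 / 2 + t * I + h)).re = v t := fun t ↦ by
    rw [hvdef, hpt]
  have hpos' : ∀ t : ℝ, 0 < v t := fun t ↦ by rw [← hvpt]; exact hpos t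
  have hv' : ∀ η : ℝ, 0 < η → ∃ T₀ : ℝ, ∀ t : ℝ, T₀ ≤ |t| →
      |v t - 1 / 2 * Real.log (|t|)| ≤ η * Real.log |t| := by
    intro η hη
    obtain ⟨T₀, hT₀⟩ := hv η hη
    exact ⟨T₀, fun t ht ↦ by rw [← hvpt]; exact hT₀ t ht⟩
  have hξ : ∀ t : ℝ, riemannXi ((x : ℂ) + t * I) ≠ 0 := fun t h0 ↦ by
    have := hpos' t
    rw [hvdef] at this
    simp only [logDeriv_apply, h0, div_zero, zero_re] at this
    exact lt_irrefl _ this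
  have hcontv : Continuous v := by
    rw [hvdef]
    refine Complex.continuous_re.comp (continuous_iff_continuousAt.2 fun u ↦ ?_)
    have h1 : ContinuousAt (fun u : ℝ ↦ (x : ℂ) + u * I) u := by fun_prop
    have h2 : ContinuousAt (logDeriv riemannXi) ((x : ℂ) + u * I) := continuousAt_logDeriv_riemannXi (hξ u)
    exact h2.comp (f := fun u : ℝ ↦ (x : ℂ) + u * I) h1
  -- a uniform lower bound `c ≤ v`: `v ≥ ¼ log 2` far out, and a positive minimum on the compact remainder
  obtain ⟨T₀, hT₀⟩ := hv' (1 / 4) (by norm_num)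
  set T₁ : ℝ := max T₀ 2 with hT₁
  have hlog2 : 0 < Real.log 2 := Real.log_pos (by norm_num)
  have hfar : ∀ t : ℝ, T₁ ≤ |t| → 1 / 4 * Real.log 2 ≤ v t := by
    intro t ht
    have h2t : 2 ≤ |t| := le_trans (le_max_right _ _) ht
    have hlogt : Real.log 2 ≤ Real.log |t| := Real.log_le_log (by norm_num) h2t
    have hb := (abs_le.1 (hT₀ t (le_trans (le_max_left _ _) ht))).1
    linarith
  have hT₁0 : 0 ≤ T₁ := le_trans (by norm_num) (le_max_right T₀ 2)
  obtain ⟨t₀, -, ht₀min⟩ := (isCompact_Icc (a := -T₁) (b := T₁)).exists_isMinOn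
    (nonempty_Icc.2 (by linarith)) hcontv.continuousOn
  set c : ℝ := min (1 / 4 * Real.log 2) (v t₀) with hcdef
  have hc : 0 < c := lt_min (by positivity) (hpos' t₀)
  have hcv : ∀ t, c ≤ v t := by
    intro t
    rcases le_or_gt T₁ |t| with ht | ht
    · exact le_trans (min_le_left _ _) (hfar t ht)
    · have hmem : t ∈ Icc (-T₁) T₁ := abs_le.1 ht.le
      exact le_trans (min_le_right _ _) ((isMinOn_iff.1 ht₀min) t hmem)
  -- the phase `φ(t) = ∫₀ᵗ v`
  set φ : ℝ → ℝ := fun t ↦ ∫ u in (0:ℝ)..t, v u with hφ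
  have hφd : ∀ t : ℝ, HasDerivAt φ (v t) t := fun t ↦ (hcontv.integral_hasStrictDerivAt 0 t).hasDerivAt
  -- the path `W(t) = e^{iθ} ξ(x + it)` and its polar form
  set W : ℝ → ℂ := fun t ↦ cexp (θ * I) * riemannXi ((x : ℂ) + t * I) with hW
  set W' : ℝ → ℂ := fun t ↦ cexp (θ * I) * (deriv riemannXi ((x : ℂ) + t * I) * I) with hW'
  have hWd : ∀ t, HasDerivAt W (W' t) t := by
    intro t
    have hp : HasDerivAt (fun t : ℝ ↦ (x : ℂ) + t * I) I t := by
      have := ((hasDerivAt_id t).ofReal_comp).mul_const I |>.const_add (x : ℂ)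
      simpa using this
    have hξ' : HasDerivAt riemannXi (deriv riemannXi ((x : ℂ) + t * I)) ((x : ℂ) + t * I) :=
      (differentiable_riemannXi _).hasDerivAt
    have := (hξ'.comp t hp).const_mul (cexp (θ * I))
    simpa [hW, hW', Function.comp_def] using this
  have hW'c : Continuous W' :=
    continuous_const.mul ((continuous_deriv_riemannXi.comp (by fun_prop)).mul continuous_const)
  have hWc : Continuous W := continuous_iff_continuousAt.2 fun t ↦ (hWd t).continuousAt
  have hW0 : ∀ t, W t ≠ 0 := fun t ↦ mul_ne_zero (Complex.exp_ne_zero _) (hξ t)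
  have hquot : ∀ t, W' t / W t = I * logDeriv riemannXi ((x : ℂ) + t * I) := fun t ↦ by
    simp only [hW, hW']
    rw [mul_div_mul_left _ _ (Complex.exp_ne_zero _), logDeriv_apply]
    ring
  have hIm : ∀ t, (∫ u in (0:ℝ)..t, W' u / W u).im = φ t := by
    intro t
    have hi : IntervalIntegrable (fun u ↦ W' u / W u) volume 0 t := (hW'c.div hWc hW0).intervalIntegrable 0 t
    rw [im_intervalIntegral_eq hi]
    simp only [hquot, mul_im, I_re, I_im, zero_mul, one_mul, zero_add, hφ, hvdef]
  -- the zero dictionary: `A_{h,θ}(½+it) = 0 ⟺ cos(arg W(0) + φ(t)) = 0`, `B ⟺ sin = 0`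
  have hzA : ∀ t : ℝ, t ∈ critZeroOrdinates (diffXiArot h θ) ↔
      Real.sin (arg (W 0) + φ t + π / 2) = 0 := by
    intro t
    rw [mem_critZeroOrdinates, diffXiArot_critical_eq_zero_iff, hpt t]
    change (W t).re = 0 ↔ _
    rw [(re_eq_zero_iff_cos_of_hasDerivAt hWd hW'c hW0 t).1, hIm, Real.sin_add_pi_div_two]
  have hzB : ∀ t : ℝ, t ∈ critZeroOrdinates (diffXiBrot h θ) ↔ Real.sin (arg (W 0) + φ t) = 0 := by
    intro t
    rw [mem_critZeroOrdinates, diffXiBrot_critical_eq_zero_iff, hpt t]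
    change (W t).im = 0 ↔ _
    rw [(re_eq_zero_iff_cos_of_hasDerivAt hWd hW'c hW0 t).2, hIm]
  have hΨA : ∀ t, HasDerivAt (fun t ↦ arg (W 0) + φ t + π / 2) (v t) t := fun t ↦
    ((hφd t).const_add _).add_const _
  have hΨB : ∀ t, HasDerivAt (fun t ↦ arg (W 0) + φ t) (v t) t := fun t ↦ (hφd t).const_add _
  exact ⟨hasTrivialSpacingDistribution_of_phase hΨA hc hcv hv' hzA k,
    hasTrivialSpacingDistribution_of_phase hΨB hc hcv hv' hzB k⟩

/-! ## E. The velocity of the phase of `ξ` on `Re s = ½ + h`; `R_h(T)`; Theorem 4.1 -/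

/-- **The phase velocity of `ξ` on a vertical line** — the display after (4.4),
`φ_h′(t) = Re ξ′/ξ(½ + h + it) = ½ log(t/2π) + O(1/t) + Re ζ′/ζ(½ + h + it)`, with an explicit constant:
for `Re s > 0`, `|Im s| ≥ 1`, `ζ(s) ≠ 0`,
`|Re ξ′/ξ(s) − ½ log(|Im s|/2π) − Re ζ′/ζ(s)| ≤ (2 Re s + |Re s − 1| + 2)/|Im s|`. From
`ξ′/ξ = 1/s + 1/(s − 1) + Γℝ′/Γℝ + ζ′/ζ` (`logDeriv_riemannXi_eq_add_logDeriv_riemannZeta`),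
`Γℝ′/Γℝ(s) = −½ log π + ½ ψ(s/2)` (`logDeriv_Gammaℝ`) and the vertical Stirling bound
`|Re ψ(w) − log ‖w‖| ≤ 1/(2‖w‖²) + π/(4|Im w|)` (`abs_re_digamma_sub_log_norm_le`).
[cite: Lagarias2005, proof of Theorem 4.1, display after (4.4) (arXiv p. 9; held text p0009)] -/
theorem abs_re_logDeriv_xi_sub_le {s : ℂ} (hs : 0 < s.re) (ht : 1 ≤ |s.im|) (hζ : riemannZeta s ≠ 0) :
    |(logDeriv riemannXi s).re - 1 / 2 * Real.log (|s.im| / (2 * π)) -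
        (deriv riemannZeta s / riemannZeta s).re| ≤ (2 * s.re + |s.re - 1| + 2) / |s.im| := by
  have hπ := Real.pi_pos
  have him0 : s.im ≠ 0 := fun h ↦ by rw [h, abs_zero] at ht; linarith
  have htpos : 0 < |s.im| := abs_pos.2 him0
  have hs1 : s ≠ 1 := fun h ↦ him0 (by rw [h]; simp)
  rw [logDeriv_apply, logDeriv_riemannXi_eq_add_logDeriv_riemannZeta hs hs1 hζ,
    Literature.NumberTheory.LFunctions.logDeriv_Gammaℝ (half_ne_neg_nat_of_re_pos' hs),
    ← Complex.ofReal_log hπ.le]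
  set w : ℂ := s / 2 with hw
  have hwre : 0 < w.re := by rw [hw, Complex.div_ofNat_re]; exact half_pos hs
  have hwim : w.im = s.im / 2 := by rw [hw, Complex.div_ofNat_im]
  have hwim0 : w.im ≠ 0 := by rw [hwim]; exact div_ne_zero him0 two_ne_zero
  have hψ := Literature.Analysis.SpecialFunctions.Complex.abs_re_digamma_sub_log_norm_le hwre hwim0
  have hwnorm : |s.im| / 2 ≤ ‖w‖ := by
    have := Complex.abs_im_le_norm w
    rwa [hwim, abs_div, abs_two] at this
  have hw0 : 0 < ‖w‖ := lt_of_lt_of_le (by positivity) hwnorm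
  have hlogt : Real.log (|s.im| / (2 * π)) = Real.log (|s.im| / 2) - Real.log π := by
    rw [show |s.im| / (2 * π) = |s.im| / 2 / π by ring, Real.log_div (by positivity) hπ.ne']
  -- the four pieces
  have hA : |(s⁻¹).re| ≤ s.re / |s.im| := by
    have hre' : (s⁻¹).re = s.re / (s.re ^ 2 + s.im ^ 2) := by
      rw [Complex.inv_re, Complex.normSq_apply]; ring
    rw [hre', abs_of_nonneg (by positivity)]
    exact div_le_div_of_nonneg_left hs.le htpos (by nlinarith [sq_nonneg s.re, sq_abs s.im])
  have hB : |((s - 1)⁻¹).re| ≤ |s.re - 1| / |s.im| := by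
    have hre' : ((s - 1)⁻¹).re = (s.re - 1) / ((s.re - 1) ^ 2 + s.im ^ 2) := by
      rw [Complex.inv_re, Complex.normSq_apply, Complex.sub_re, Complex.one_re, Complex.sub_im,
        Complex.one_im, sub_zero]; ring
    have hden : 0 < (s.re - 1) ^ 2 + s.im ^ 2 := by nlinarith [sq_nonneg (s.re - 1), sq_abs s.im]
    rw [hre', abs_div, abs_of_pos hden]
    exact div_le_div_of_nonneg_left (abs_nonneg _) htpos (by nlinarith [sq_nonneg (s.re - 1), sq_abs s.im])
  have hD : |(digamma w).re - Real.log ‖w‖| ≤ 4 / |s.im| := by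
    refine hψ.trans ?_
    have hsq' : |s.im| * |s.im| ≤ 4 * ‖w‖ ^ 2 := by nlinarith [hwnorm, abs_nonneg s.im]
    have h1 : 1 / (2 * ‖w‖ ^ 2) ≤ 2 / |s.im| := by
      rw [div_le_div_iff₀ (by positivity) htpos]
      nlinarith [hsq', ht]
    have h2 : π / (4 * |w.im|) ≤ 2 / |s.im| := by
      rw [hwim, abs_div, abs_two, show 4 * (|s.im| / 2) = 2 * |s.im| by ring,
        div_le_div_iff₀ (by positivity) htpos]
      nlinarith [Real.pi_le_four, htpos]
    have e4 : 2 / |s.im| + 2 / |s.im| = 4 / |s.im| := by ring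
    linarith
  have hL : |Real.log ‖w‖ - Real.log (|s.im| / 2)| ≤ s.re / |s.im| := by
    have ht2 : 0 < |s.im| / 2 := by positivity
    have hlo : Real.log (|s.im| / 2) ≤ Real.log ‖w‖ := Real.log_le_log ht2 hwnorm
    have hsnorm : ‖s‖ ≤ s.re + |s.im| := by
      have e' : (s.re : ℂ) + (s.im : ℂ) * I = s := Complex.re_add_im s
      have := norm_add_le (s.re : ℂ) ((s.im : ℂ) * I)
      rw [e', Complex.norm_real, Real.norm_eq_abs, abs_of_pos hs, norm_mul, Complex.norm_I, mul_one,
        Complex.norm_real, Real.norm_eq_abs] at this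
      exact this
    have hwle : ‖w‖ ≤ (s.re + |s.im|) / 2 := by
      rw [hw, norm_div, Complex.norm_ofNat]; linarith
    have hhi : Real.log ‖w‖ - Real.log (|s.im| / 2) ≤ s.re / |s.im| := by
      rw [← Real.log_div hw0.ne' ht2.ne']
      refine (Real.log_le_sub_one_of_pos (by positivity)).trans ?_
      rw [sub_le_iff_le_add, div_le_iff₀ ht2]
      have e' : (s.re / |s.im| + 1) * (|s.im| / 2) = (s.re + |s.im|) / 2 := by
        field_simp
      rw [e']; exact hwle
    rw [abs_of_nonneg (by linarith)]
    exact hhi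
  obtain ⟨hA1, hA2⟩ := abs_le.1 hA
  obtain ⟨hB1, hB2⟩ := abs_le.1 hB
  obtain ⟨hD1, hD2⟩ := abs_le.1 hD
  obtain ⟨hL1, hL2⟩ := abs_le.1 hL
  have hx' : 0 ≤ s.re / |s.im| := div_nonneg hs.le (abs_nonneg _)
  have eK : (2 * s.re + |s.re - 1| + 2) / |s.im| =
      s.re / |s.im| + |s.re - 1| / |s.im| + 1 / 2 * (4 / |s.im| + s.re / |s.im|) + 1 / 2 * (s.re / |s.im|) := by
    ring
  simp only [Complex.add_re, Complex.neg_re, Complex.div_ofNat_re, Complex.ofReal_re, hlogt]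
  rw [eK, abs_le]
  constructor <;> linarith

/-- **`|ζ′/ζ(½ + h + it)| ≤ R_h(T)` for `t ∈ [T, T+1]`**, `T > 0`, when `ζ ≠ 0` on that segment of
`Re s = ½ + h`: the supremum defining `R_h(T)` (`zetaLogDerivSup`) is then over the image of a compact
segment under a continuous function. [cite: Lagarias2005, §4 p. 8 (definition of R_h(T)) and (4.5) p. 9] -/
theorem norm_logDeriv_zeta_le_zetaLogDerivSup {h T t : ℝ} (hT : 0 < T)
    (hζ : ∀ u ∈ Icc T (T + 1), riemannZeta (1 / 2 + h + u * I) ≠ 0) (ht : t ∈ Icc T (T + 1)) :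
    ‖deriv riemannZeta (1 / 2 + h + t * I) / riemannZeta (1 / 2 + h + t * I)‖ ≤ zetaLogDerivSup h T := by
  have h1 : ∀ u ∈ Icc T (T + 1), (1 / 2 + h + u * I : ℂ) ≠ 1 := by
    intro u hu h1
    have := congrArg Complex.im h1
    simp at this
    linarith [hu.1]
  have hcont : ContinuousOn
      (fun u : ℝ ↦ ‖deriv riemannZeta (1 / 2 + h + u * I) / riemannZeta (1 / 2 + h + u * I)‖)
      (Icc T (T + 1)) := by
    refine ContinuousOn.norm fun u hu ↦ ContinuousAt.continuousWithinAt ?_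
    have hp : ContinuousAt (fun u : ℝ ↦ (1 / 2 + h + u * I : ℂ)) u := by fun_prop
    exact (continuousAt_logDeriv_riemannZeta (h1 u hu) (hζ u hu)).comp
      (f := fun u : ℝ ↦ (1 / 2 + h + u * I : ℂ)) hp
  rw [zetaLogDerivSup]
  exact le_csSup (isCompact_Icc.bddAbove_image hcont) (mem_image_of_mem _ ht)

/-- **From `R_h(T) = o(log T)` to the velocity estimate** `|Re ξ′/ξ(½ + h + it) − ½ log|t|| ≤ η log|t|`
(`|t| ≥ T₀(η)`, every `η > 0`): by `abs_re_logDeriv_xi_sub_le`, (4.5) `|ζ′/ζ| ≤ R_h`, and the symmetry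
`ξ′/ξ(s̄) = conj ξ′/ξ(s)` for `t < 0`; `ζ` is required zero-free on `Re s = ½ + h`, `Im s ≥ 1`.
[cite: Lagarias2005, proof of Theorem 4.1, (4.5) (arXiv p. 9; held text p0009)] -/
theorem abs_re_logDeriv_xi_sub_half_log_le {h : ℝ} (hx : 0 < 1 / 2 + h)
    (hζ : ∀ u : ℝ, 1 ≤ u → riemannZeta (1 / 2 + h + u * I) ≠ 0)
    (hR : ∀ η : ℝ, 0 < η → ∃ T₀ : ℝ, ∀ T : ℝ, T₀ ≤ T → zetaLogDerivSup h T ≤ η * Real.log T) :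
    ∀ η : ℝ, 0 < η → ∃ T₀ : ℝ, ∀ t : ℝ, T₀ ≤ |t| →
      |(logDeriv riemannXi (1 / 2 + t * I + h)).re - 1 / 2 * Real.log (|t|)| ≤ η * Real.log |t| := by
  intro η hη
  have hπ := Real.pi_pos
  set x : ℝ := 1 / 2 + h with hxdef
  obtain ⟨K, hK⟩ : ∃ K : ℝ, K = 2 * x + |x - 1| + 2 := ⟨_, rfl⟩
  have hK0 : 0 < K := by rw [hK]; positivity
  have hlog2π : 0 < Real.log (2 * π) := Real.log_pos (by linarith [Real.pi_gt_three])
  obtain ⟨T₀, hT₀⟩ := hR (η / 2) (half_pos hη)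
  set M : ℝ := Real.exp ((K + Real.log (2 * π)) / (η / 2)) with hM
  refine ⟨max (max T₀ 1) M, fun t ht ↦ ?_⟩
  have ht1 : 1 ≤ |t| := le_trans (le_trans (le_max_right _ _) (le_max_left _ _)) ht
  have htT₀ : T₀ ≤ |t| := le_trans (le_trans (le_max_left _ _) (le_max_left _ _)) ht
  have htM : M ≤ |t| := le_trans (le_max_right _ _) ht
  have htpos : 0 < |t| := by linarith
  have hlogt : (K + Real.log (2 * π)) / (η / 2) ≤ Real.log |t| := by
    rw [← Real.log_exp ((K + Real.log (2 * π)) / (η / 2))]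
    exact Real.log_le_log (Real.exp_pos _) htM
  have hbig : K + Real.log (2 * π) ≤ Real.log |t| * (η / 2) := (div_le_iff₀ (half_pos hη)).1 hlogt
  -- reduce to `u = |t| > 0` by the conjugation symmetry of `ξ′/ξ`
  set u : ℝ := |t| with hu
  have hsym : (logDeriv riemannXi (1 / 2 + t * I + h)).re =
      (logDeriv riemannXi (1 / 2 + u * I + h)).re := by
    rcases le_or_gt 0 t with h0 | h0
    · rw [hu, abs_of_nonneg h0]
    · rw [hu, abs_of_neg h0]
      have e : (1 / 2 : ℂ) + t * I + h = conj (1 / 2 + ((-t : ℝ) : ℂ) * I + h) := by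
        apply Complex.ext <;> simp
      rw [e, logDeriv_riemannXi_conj, Complex.conj_re]
  rw [hsym]
  set s : ℂ := 1 / 2 + u * I + h with hs
  have es : s = 1 / 2 + h + u * I := by rw [hs]; ring
  have hsre : s.re = x := by simp [hs, hxdef]
  have hsim : s.im = u := by simp [hs]
  have hs0 : 0 < s.re := by rw [hsre]; exact hx
  have hsim1 : 1 ≤ |s.im| := by rw [hsim, abs_of_pos htpos]; exact ht1
  have hζs : riemannZeta s ≠ 0 := by rw [es]; exact hζ u ht1
  have hE := abs_re_logDeriv_xi_sub_le hs0 hsim1 hζs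
  rw [hsre, hsim, abs_of_pos htpos, ← hK, Real.log_div htpos.ne' (by positivity)] at hE
  -- (4.5): `|Re ζ′/ζ(s)| ≤ R_h(u) ≤ (η/2) log u`
  have hZ : |(deriv riemannZeta s / riemannZeta s).re| ≤ η / 2 * Real.log u := by
    refine (Complex.abs_re_le_norm _).trans ?_
    rw [es]
    exact (norm_logDeriv_zeta_le_zetaLogDerivSup htpos (fun u' hu' ↦ hζ u' (le_trans ht1 hu'.1))
      (left_mem_Icc.2 (by linarith))).trans (hT₀ u htT₀)
  have hKt : K / u ≤ K := div_le_self hK0.le ht1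
  obtain ⟨hE1, hE2⟩ := abs_le.1 hE
  obtain ⟨hZ1, hZ2⟩ := abs_le.1 hZ
  rw [abs_le]
  constructor <;> linarith

/-- `R ≤ C` everywhere gives `R(T) ≤ η log T` for `T` large, every `η > 0`. [folklore] -/
private theorem le_mul_log_of_bounded {R : ℝ → ℝ} {C : ℝ} (hC : ∀ T, R T ≤ C) :
    ∀ η : ℝ, 0 < η → ∃ T₀ : ℝ, ∀ T : ℝ, T₀ ≤ T → R T ≤ η * Real.log T := by
  intro η hη
  refine ⟨max 1 (Real.exp (|C| / η)), fun T hT ↦ ?_⟩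
  have hlog : |C| / η ≤ Real.log T := by
    rw [← Real.log_exp (|C| / η)]
    exact Real.log_le_log (Real.exp_pos _) (le_trans (le_max_right _ _) hT)
  have := le_abs_self C
  rw [div_le_iff₀ hη] at hlog
  linarith [hC T]

/-- `R = O(log T/log log T)` at `+∞` gives `R(T) ≤ η log T` for `T` large, every `η > 0`. [folklore] -/
private theorem le_mul_log_of_isBigO_log_div_loglog {R : ℝ → ℝ}
    (hR : R =O[atTop] fun T : ℝ ↦ Real.log T / Real.log (Real.log T)) :
    ∀ η : ℝ, 0 < η → ∃ T₀ : ℝ, ∀ T : ℝ, T₀ ≤ T → R T ≤ η * Real.log T := by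
  intro η hη
  obtain ⟨C, hC0, hCw⟩ := hR.exists_pos
  obtain ⟨T₁, hT₁⟩ := Filter.eventually_atTop.1 hCw.bound
  refine ⟨max T₁ (Real.exp (Real.exp (C / η))), fun T hT ↦ ?_⟩
  have hTT₁ : T₁ ≤ T := le_trans (le_max_left _ _) hT
  have hTe : Real.exp (Real.exp (C / η)) ≤ T := le_trans (le_max_right _ _) hT
  have hlogT : Real.exp (C / η) ≤ Real.log T := by
    rw [← Real.log_exp (Real.exp (C / η))]; exact Real.log_le_log (Real.exp_pos _) hTe
  have hlogT0 : 0 < Real.log T := lt_of_lt_of_le (Real.exp_pos _) hlogT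
  have hll : C / η ≤ Real.log (Real.log T) := by
    rw [← Real.log_exp (C / η)]; exact Real.log_le_log (Real.exp_pos _) hlogT
  have hll0 : 0 < Real.log (Real.log T) := lt_of_lt_of_le (by positivity) hll
  have hb := hT₁ T hTT₁
  rw [Real.norm_eq_abs, Real.norm_eq_abs, abs_of_pos (div_pos hlogT0 hll0)] at hb
  have hRle : R T ≤ C * (Real.log T / Real.log (Real.log T)) := (le_abs_self _).trans hb
  have hkey : C * (Real.log T / Real.log (Real.log T)) ≤ η * Real.log T := by
    rw [mul_div_assoc', div_le_iff₀ hll0]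
    rw [div_le_iff₀ hη] at hll
    nlinarith
  exact hRle.trans hkey

/-- `R = O((log T)^e)` at `+∞` with `e < 1` gives `R(T) ≤ η log T` for `T` large, every `η > 0`. [folklore] -/
private theorem le_mul_log_of_isBigO_log_rpow {R : ℝ → ℝ} {e : ℝ} (he : e < 1)
    (hR : R =O[atTop] fun T : ℝ ↦ Real.log T ^ e) :
    ∀ η : ℝ, 0 < η → ∃ T₀ : ℝ, ∀ T : ℝ, T₀ ≤ T → R T ≤ η * Real.log T := by
  intro η hη
  obtain ⟨C, hC0, hCw⟩ := hR.exists_pos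
  obtain ⟨T₁, hT₁⟩ := Filter.eventually_atTop.1 hCw.bound
  have h1e : 0 < 1 - e := by linarith
  set M : ℝ := (C / η) ^ (1 / (1 - e)) with hM
  have hM0 : 0 ≤ M := Real.rpow_nonneg (by positivity) _
  refine ⟨max T₁ (Real.exp (max M 1)), fun T hT ↦ ?_⟩
  have hTT₁ : T₁ ≤ T := le_trans (le_max_left _ _) hT
  have hlogT : max M 1 ≤ Real.log T := by
    rw [← Real.log_exp (max M 1)]
    exact Real.log_le_log (Real.exp_pos _) (le_trans (le_max_right _ _) hT)
  have hL1 : 1 ≤ Real.log T := le_trans (le_max_right _ _) hlogT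
  have hL0 : 0 < Real.log T := by linarith
  have hLM : M ≤ Real.log T := le_trans (le_max_left _ _) hlogT
  have hb := hT₁ T hTT₁
  rw [Real.norm_eq_abs, Real.norm_eq_abs, abs_of_pos (Real.rpow_pos_of_pos hL0 e)] at hb
  have hRle : R T ≤ C * Real.log T ^ e := (le_abs_self _).trans hb
  have hpow : C / η ≤ Real.log T ^ (1 - e) := by
    have hMe : M ^ (1 - e) = C / η := by
      rw [hM, ← Real.rpow_mul (by positivity), one_div_mul_cancel h1e.ne', Real.rpow_one]
    rw [← hMe]
    exact Real.rpow_le_rpow hM0 hLM h1e.le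
  have hC' : C ≤ Real.log T ^ (1 - e) * η := (div_le_iff₀ hη).1 hpow
  have hpe : 0 < Real.log T ^ e := Real.rpow_pos_of_pos hL0 e
  have hkey : C * Real.log T ^ e ≤ η * Real.log T :=
    calc C * Real.log T ^ e ≤ Real.log T ^ (1 - e) * η * Real.log T ^ e :=
          mul_le_mul_of_nonneg_right hC' hpe.le
      _ = η * (Real.log T ^ (1 - e) * Real.log T ^ e) := by ring
      _ = η * Real.log T := by rw [← Real.rpow_add hL0, sub_add_cancel, Real.rpow_one]
  exact hRle.trans hkey

/-- **Theorem 4.1 for `(h, θ)` from the data at `|h|`**: positivity of the velocity on `Re s = ½ + |h|`, no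
zeros of `ζ` on that line at height `≥ 1`, and `R_{|h|}(T) = o(log T)`; `h < 0` is reduced to `−h > 0` by
`A_{−h,θ} = A_{h,−θ}`, `B_{−h,θ} = −B_{h,−θ}`, which have the same critical zero ordinates ("without loss
of generality `h > 0`"). [cite: Lagarias2005, Theorem 4.1, proof (arXiv pp. 8–9; held text p0008:L89–p0009)] -/
theorem hasTrivialSpacingDistribution_diffXi_of_abs {h : ℝ}
    (hpos : ∀ t : ℝ, 0 < (logDeriv riemannXi (1 / 2 + t * I + |h|)).re)
    (hζ : ∀ u : ℝ, 1 ≤ u → riemannZeta (1 / 2 + |h| + u * I) ≠ 0)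
    (hR : ∀ η : ℝ, 0 < η → ∃ T₀ : ℝ, ∀ T : ℝ, T₀ ≤ T → zetaLogDerivSup |h| T ≤ η * Real.log T)
    (θ : ℝ) (k : ℕ) :
    HasTrivialSpacingDistribution (diffXiArot h θ) k ∧ HasTrivialSpacingDistribution (diffXiBrot h θ) k := by
  have hx : 0 < 1 / 2 + |h| := by positivity
  have hv := abs_re_logDeriv_xi_sub_half_log_le hx hζ hR
  rcases le_or_gt 0 h with h0 | h0
  · rw [abs_of_nonneg h0] at hpos hv
    exact hasTrivialSpacingDistribution_diffXi_of_velocity hpos hv θ k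
  · rw [abs_of_neg h0] at hpos hv
    obtain ⟨hA, hB⟩ := hasTrivialSpacingDistribution_diffXi_of_velocity hpos hv (-θ) k
    have eA : diffXiArot h θ = diffXiArot (-h) (-θ) := by rw [diffXiArot_neg, neg_neg]
    have eB : critZeroOrdinates (diffXiBrot h θ) = critZeroOrdinates (diffXiBrot (-h) (-θ)) := by
      rw [diffXiBrot_neg, neg_neg]
      ext t
      simp only [mem_critZeroOrdinates, Pi.neg_apply, neg_eq_zero]
    rw [eA]
    exact ⟨hA, (hasTrivialSpacingDistribution_congr eB k).2 hB⟩

end Lagarias2005Spacing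

open Lagarias2005Spacing

/-- `Re(½ + it + h) = ½ + h`. [folklore] -/
private theorem re_half_add_mul_I_add' (h t : ℝ) : ((1 / 2 : ℂ) + t * I + h).re = 1 / 2 + h := by simp

/-- `Re(½ + h + iu) = ½ + h`. [folklore] -/
private theorem re_half_add_add_mul_I (h u : ℝ) : ((1 / 2 : ℂ) + h + u * I).re = 1 / 2 + h := by simp

/-- **Lagarias 2005, Theorem 4.1 (1)** — discharge of `lagarias2005_thm_4_1_1` (RH-FREE): for `|h| ≥ ½`,
every `0 ≤ θ < 2π` and `k ≥ 1`, the `k` consecutive normalised zero spacings of `A_{h,θ}` and of `B_{h,θ}`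
have the trivial limiting distribution `δ_{(1,…,1)}`. Inputs, as printed: the phase dictionary of the
proof of Theorem 3.1, the velocity `φ_h′(t) = ½ log(t/2π) + O(1/t) + Re ζ′/ζ(½ + h + it)`, and Lemma 4.1
(1) (`|h| > ½`: `lagarias2005_lemma_4_1_1_holds`) and (2) (`|h| = ½`: `lagarias2005_lemma_4_1_2_holds`),
each giving `R_h(T) = o(log T)`; positivity of the velocity is `Re ξ′/ξ > 0` on `Re s ≥ 1`
(`Lagarias1999Eq14.re_logDeriv_riemannXi_pos_of_one_le_re`), and `ζ ≠ 0` on `Re s ≥ 1`.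
[cite: Lagarias2005, Theorem 4.1 (1) (arXiv p. 8; held text p0008:L71–80)] -/
theorem lagarias2005_thm_4_1_1_holds : lagarias2005_thm_4_1_1 := by
  intro k _ h θ hh _ _
  refine hasTrivialSpacingDistribution_diffXi_of_abs (fun t ↦ ?_) (fun u _ ↦ ?_) ?_ θ k
  · exact Lagarias1999Eq14.re_logDeriv_riemannXi_pos_of_one_le_re (by rw [re_half_add_mul_I_add']; linarith)
  · exact riemannZeta_ne_zero_of_one_le_re (by rw [re_half_add_add_mul_I]; linarith)
  · rcases hh.lt_or_eq with hlt | heq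
    · obtain ⟨C, hC⟩ := lagarias2005_lemma_4_1_1_holds |h| hlt
      exact le_mul_log_of_bounded hC
    · rw [← heq]
      exact le_mul_log_of_isBigO_log_div_loglog lagarias2005_lemma_4_1_2_holds

/-- **Lagarias 2005, Theorem 4.1 (2) from Lemma 4.1 (3)** (RH-CONSEQUENCE; the RH binder of the statement is
kept as its hypothesis, never dropped and never asserted): assuming the named fact `lagarias2005_lemma_4_1_3`
(under RH, `R_h(T) = O((log T)^{1−2h})` for `0 < h < ½` — [Titchmarsh1986, Thm 14.5], taken BY NAME), Theorem
4.1 (2) follows by the same argument, the positivity of the velocity being `RH ⟹ Re ξ′/ξ > 0` on `Re s > ½`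
(`Lagarias1999_riemannHypothesis_iff_holds`) and `ζ ≠ 0` off the critical line under RH
(`riemannZeta_ne_zero_of_riemannHypothesis`). [cite: Lagarias2005, Theorem 4.1 (2) (arXiv p. 8; held text p0008:L81–87)] -/
theorem lagarias2005_thm_4_1_2_of_lemma_4_1_3 (h413 : lagarias2005_lemma_4_1_3) :
    lagarias2005_thm_4_1_2 := by
  intro hRH k _ h θ hh0 hh _ _
  refine hasTrivialSpacingDistribution_diffXi_of_abs (fun t ↦ ?_) (fun u _ ↦ ?_) ?_ θ k
  · exact Lagarias1999_riemannHypothesis_iff_holds.1 hRH _ (by rw [re_half_add_mul_I_add']; linarith)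
  · exact riemannZeta_ne_zero_of_riemannHypothesis hRH (by rw [re_half_add_add_mul_I]; positivity)
      (by rw [re_half_add_add_mul_I]; exact ne_of_gt (by linarith))
  · exact le_mul_log_of_isBigO_log_rpow (by linarith) (h413 hRH |h| hh0 hh)

end Literature.NumberTheory.LFunctions
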